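import Mathlib.RingTheory.LocalRing.Module
import Literature.RingTheory.CohomologyAnnihilator.StableAnnihilation
import Literature.RingTheory.CohomologyAnnihilator.TowerBasic
import HarnessLib

/-!
# Minimal free covers over a local ring, and «the socle annihilates positive Ext» (Iyengar–Takahashi, Example 2.6)

Topic: `Literature/RingTheory/CohomologyAnnihilator`.

* `exists_surjective_ker_le_maximalIdeal_smul` — **minimal free cover**: every finitely generated module `M` over a local
  ring `(R, 𝔪)` admits a surjection `π : Rⁿ → M` with `ker π ≤ 𝔪 Rⁿ` (lift a basis of `k ⊗_R M` by Nakayama,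
  `IsLocalRing.span_eq_top_of_tmul_eq_basis`; a relation with a unit coefficient would contradict linear independence in
  `k ⊗ M`). [cite: Matsumura1987, Thm. 2.3 (minimal bases over a local ring)]
* `smul_ext_eq_zero_of_smul_maximalIdeal_eq_zero` — if `a 𝔪 = 0` (i.e. `a ∈ soc R`) then `a • Extⁱ_R(M, N) = 0` for every
  finitely generated `M`, every `N` and every `i ≥ 1`: `a` kills the first syzygy `K ⊆ 𝔪Rⁿ`, so `a • 𝟙_K = 0` factors through
  `Rⁿ`, whence `a • [0 → K → Rⁿ → M → 0] = 0` and `a` kills all positive `Ext` of `M` (splitting criterion of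
  `StableAnnihilation`). [cite: IyengarTakahashi2014, Example 2.6]
* `mem_cohomologyAnnihilatorOfDegree_one_of_smul_maximalIdeal_eq_zero` — hence `soc R ⊆ ca¹(R)`, and
  `maximalIdeal_pow_le_cohomologyAnnihilatorOfDegree_one` — if `𝔪^ℓ = 0` then `𝔪^{ℓ−1} ⊆ ca¹(R)`.
  [cite: IyengarTakahashi2014, Example 2.6]

## References
* H. Matsumura, *Commutative Ring Theory*, CUP 1986/1989, Theorem 2.3. [`Matsumura1987`]
* S. B. Iyengar, R. Takahashi, *Annihilation of cohomology and strong generation of module categories*, IMRN 2016,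
  arXiv:1404.1476, Example 2.6. [`IyengarTakahashi2014`]
-/

noncomputable section

open CategoryTheory CategoryTheory.Abelian CategoryTheory.Limits
open TensorProduct

universe u

namespace Literature.RingTheory.CohomologyAnnihilator

variable {R : Type u} [CommRing R] [IsLocalRing R]

/-- **Minimal free cover over a local ring.** A finitely generated module `M` over a local ring `(R, 𝔪)` is the image
of a free module `Rⁿ` under a surjection whose kernel lies in `𝔪 Rⁿ` (lifts of a basis of `M/𝔪M` form a minimal basis, and
every relation among a minimal basis has coefficients in `𝔪`). [cite: Matsumura1987, Thm. 2.3] -/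
theorem exists_surjective_ker_le_maximalIdeal_smul (M : Type u) [AddCommGroup M] [Module R M] [Module.Finite R M] :
    ∃ (n : ℕ) (π : (Fin n → R) →ₗ[R] M), Function.Surjective π ∧
      LinearMap.ker π ≤ (IsLocalRing.maximalIdeal R) • (⊤ : Submodule R (Fin n → R)) := by
  classical
  set k := IsLocalRing.ResidueField R with hk
  -- a finite basis of `k ⊗ M`
  let b := Module.finBasis k (k ⊗[R] M)
  set n := Module.finrank k (k ⊗[R] M) with hn
  -- lift the basis vectors along the surjection `m ↦ 1 ⊗ m`
  have hsurj : Function.Surjective (TensorProduct.mk R k M 1) :=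
    TensorProduct.mk_surjective R M k Ideal.Quotient.mk_surjective
  choose f hf using fun i : Fin n => hsurj (b i)
  have hspan : Submodule.span R (Set.range f) = ⊤ :=
    IsLocalRing.span_eq_top_of_tmul_eq_basis f b fun i => hf i
  -- the cover
  let π : (Fin n → R) →ₗ[R] M := Fintype.linearCombination R f
  have hπ : Function.Surjective π := by
    rw [← LinearMap.range_eq_top, Fintype.range_linearCombination, hspan]
  refine ⟨n, π, hπ, fun v hv => ?_⟩
  -- `v ∈ ker π`: all coordinates lie in `𝔪`
  rw [LinearMap.mem_ker, Fintype.linearCombination_apply] at hv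
  have hcoord : ∀ i, v i ∈ IsLocalRing.maximalIdeal R := by
    -- apply `1 ⊗ −`: `Σ (v i)‾ • b i = 0`
    have h0 : (∑ i, (algebraMap R k (v i)) • b i) = 0 := by
      have := congrArg (TensorProduct.mk R k M 1) hv
      rw [map_zero, map_sum] at this
      simp_rw [map_smul] at this
      rw [← this]
      refine Finset.sum_congr rfl fun i _ => ?_
      rw [hf i, algebraMap_smul]
    intro i
    have hi := b.linearIndependent
    rw [Fintype.linearIndependent_iff] at hi
    have := hi (fun j => algebraMap R k (v j)) h0 i
    rwa [IsLocalRing.ResidueField.algebraMap_eq, IsLocalRing.residue_eq_zero_iff] at this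
  -- hence `v = Σ v i • e i ∈ 𝔪 • ⊤`
  have hv' : v = ∑ i, v i • (Pi.single i 1 : Fin n → R) := by
    ext j
    simp [Finset.sum_apply, Pi.single_apply]
  rw [hv']
  exact Submodule.sum_mem _ fun i _ => Submodule.smul_mem_smul (hcoord i) Submodule.mem_top

/-- **The socle annihilates positive `Ext`.** If `a 𝔪 = 0` then `a • Extⁱ(M, N) = 0` for every finitely generated `M`,
every `R`-module `N` and every `i ≥ 1`. [cite: IyengarTakahashi2014, Example 2.6] -/
theorem smul_ext_eq_zero_of_smul_maximalIdeal_eq_zero {a : R}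
    (ha : ∀ x ∈ IsLocalRing.maximalIdeal R, a * x = 0)
    (M : ModuleCat.{u} R) [Module.Finite R M] (N : ModuleCat.{u} R) {i : ℕ} (hi : 1 ≤ i)
    (e : Ext.{u} M N i) : a • e = 0 := by
  obtain ⟨n, π, hπ, hker⟩ := exists_surjective_ker_le_maximalIdeal_smul (R := R) M
  set K := LinearMap.ker π with hK
  obtain ⟨w, hS⟩ := exists_shortExact_of_linearMap (Y := ModuleCat.of R K) (M := ModuleCat.of R (Fin n → R))
    (X := M) K.subtype π Subtype.val_injective hπ (LinearMap.exact_subtype_ker_map π)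
  haveI : Projective (ModuleCat.of R (Fin n → R)) :=
    (IsProjective.iff_projective (R := R) (Fin n → R)).mp inferInstance
  -- `a` kills `K ⊆ 𝔪 Rⁿ`, so `a • 𝟙_K = 0 = S.f ≫ 0`
  have haK : ∀ v : K, a • v = 0 := by
    intro v
    apply Subtype.ext
    change a • (v : Fin n → R) = 0
    have hv : (v : Fin n → R) ∈ IsLocalRing.maximalIdeal R • (⊤ : Submodule R (Fin n → R)) := hker v.2
    refine Submodule.smul_induction_on hv (fun r hr x _ => ?_) (fun x y hx hy => ?_)
    · rw [← mul_smul, ha r hr, zero_smul]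
    · rw [smul_add, hx, hy, add_zero]
  have hφ : (ShortComplex.mk (ModuleCat.ofHom K.subtype) (ModuleCat.ofHom π) w).f ≫
      (0 : ModuleCat.of R (Fin n → R) ⟶ ModuleCat.of R K) = a • 𝟙 (ModuleCat.of R K) := by
    rw [comp_zero]
    apply ModuleCat.hom_ext
    apply LinearMap.ext
    intro v
    change (0 : K) = a • v
    exact (haK v).symm
  have hcls := smul_extClass_eq_zero_of_comp_eq_smul_id hS 0 hφ
  exact smul_ext_X₃_eq_zero_of_smul_extClass_eq_zero hS hcls hi e

/-- Hence the socle lies in `ca¹(R)`: if `a 𝔪 = 0` then `a ∈ ca¹(R)`. [cite: IyengarTakahashi2014, Example 2.6] -/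
theorem mem_cohomologyAnnihilatorOfDegree_one_of_smul_maximalIdeal_eq_zero {a : R}
    (ha : ∀ x ∈ IsLocalRing.maximalIdeal R, a * x = 0) : a ∈ cohomologyAnnihilatorOfDegree R 1 := by
  rw [mem_cohomologyAnnihilatorOfDegree_iff]
  intro i hi M N hM _ e
  exact smul_ext_eq_zero_of_smul_maximalIdeal_eq_zero ha M N hi e

/-- If `𝔪^ℓ = 0` (e.g. `R` artinian of Loewy length `ℓ`) then `𝔪^{ℓ−1} ⊆ ca¹(R)`.
[cite: IyengarTakahashi2014, Example 2.6] -/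
theorem maximalIdeal_pow_le_cohomologyAnnihilatorOfDegree_one {ℓ : ℕ} (hℓ : 1 ≤ ℓ)
    (h : IsLocalRing.maximalIdeal R ^ ℓ = ⊥) :
    IsLocalRing.maximalIdeal R ^ (ℓ - 1) ≤ cohomologyAnnihilatorOfDegree R 1 := by
  intro a ha
  apply mem_cohomologyAnnihilatorOfDegree_one_of_smul_maximalIdeal_eq_zero
  intro x hx
  have hax : a * x ∈ IsLocalRing.maximalIdeal R ^ ℓ := by
    have : ℓ = (ℓ - 1) + 1 := by omega
    rw [this, pow_succ]
    exact Ideal.mul_mem_mul ha hx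
  rw [h] at hax
  exact (Submodule.mem_bot R).mp hax

end Literature.RingTheory.CohomologyAnnihilator
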